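import Literature.Analysis.FluidPDE.TimePeriodicNSLatticeOrbit
import HarnessLib

/-!
# Time-periodic Navier–Stokes on `T³` in space–time Fourier coefficients, VII: realization of
# lattice solutions as classical time-periodic fields (Iooss 1972; Henry 1981, Ch. 8; Kielhöfer 2012, §I.8)

Analysis/FluidPDE proof file (theorems only; no definitions, no named facts), sequel of
`TimePeriodicNSLatticeOrbit` on the discharge path of `Literature.Analysis.FluidPDE.PeriodicNSOrbitPersists`.
The converse of `TimePeriodicNSLatticeOrbit`: solutions of the (nonlinear, resp. linearised)
projected lattice equations with rapidly decaying coefficient families are synthesised into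
classical smooth time-periodic solutions of the forced Navier–Stokes system (resp. of the
linearised system around the orbit), the pressure being reconstructed from the curl-free,
mean-free momentum residual.

* §A bookkeeping: conjugate symmetry / summability / weighted bounds of lattice families with
  rapidly decaying extension `𝐄 c` to `ℤ⁴`, smoothness of transported products;
* §B **pressure reconstruction**: a smooth `ℂ³`-field on `T⁴` whose coefficients are killed by
  the Leray multiplier off `k = 0` and vanish on `k = 0` is a spatial gradient `∇ₓQ` of a smooth
  scalar;
* §C **nonlinear realization**: a conjugate-symmetric transversal solution `c` of
  `(2πiωn + 4π²ν|k|² + 2πi m₀·k) c + Π_k N(c,c) = [n=0] f̂(k)` with `RapidDecay (𝐄 c)` yields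
  the classical `ω⁻¹`-periodic solution `u'(t,x) = m₀ + Re F_{𝐄 c}(ωt, x)` with force `f`;
* §D **linear realization**: a transversal solution `h` of the linearised lattice equation
  around the orbit yields a smooth `τ`-periodic solution `(w, q)` of
  `∂ₜw = L_{u(t)} w − ∇q + b ∂ₜu`;
* §E **identification**: if such a `w` is a complex multiple of `∂ₜu` then `h` is the
  corresponding multiple of `(2πi n/τ) û`.

## References

* G. Iooss, Arch. Rational Mech. Anal. 47 (1972) 301–329, §2. [Iooss1972]
* D. Henry, *Geometric Theory of Semilinear Parabolic Equations*, LNM 840 (1981), Ch. 8. [Henry1981]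
* H. Kielhöfer, *Bifurcation Theory*, 2nd ed. (2012), §I.8 (PDF pp. 59–60). [Kielhofer2012]
-/

noncomputable section

open scoped BigOperators Topology ENNReal NNReal ComplexConjugate
open Filter Set Function MeasureTheory UnitAddTorus

namespace Literature.Analysis.FluidPDE

namespace TimePeriodicLattice

open Literature.Analysis.FunctionSpaces Literature.Analysis.FunctionSpaces.Torus
open Literature.Analysis.FunctionSpaces.EuclideanSpace
open Literature.Analysis.FluidPDE.ScalarFourier

-- BODY START
-- NOTATION START
/-- Local notation: the convective symbol on `ℤ × ℤ³` (as in `TimePeriodicNSLattice`). -/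
local notation:max "𝐍[" a ", " b "]" m:max =>
  (WithLp.toLp 2 (fun p : Fin 3 => ∑ j : Fin 3, ∑' m' : ℤ × (Fin 3 → ℤ),
    a m' j * (dsym j (Prod.snd m - Prod.snd m') * b (m - m') p)) : EuclideanSpace ℂ (Fin 3))

/-- Local notation: the lattice family `(n, k) ↦ C (Fin.cons n k)` of a family `C` on `ℤ⁴`. -/
local notation:max "𝐋" C:max => (fun mm : ℤ × (Fin 3 → ℤ) => C (Fin.cons (Prod.fst mm) (Prod.snd mm) : Fin 4 → ℤ))

/-- Local notation: the extension `K ↦ c (K₀, tail K)` of a lattice family to `ℤ⁴`. -/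
local notation:max "𝐄" c:max => (fun K : Fin 4 → ℤ => c ((K 0, Fin.tail K) : ℤ × (Fin 3 → ℤ)))

/-- Local notation: the lattice family `û(n,k) = 𝓕(complexify ∘ (U − m₀))(n,k)`. -/
local notation:max "𝐮[" U ", " m₀ "]" => (fun mm : ℤ × (Fin 3 → ℤ) =>
  mFourierCoeff (EuclideanSpace.complexify ∘ fun y : UnitAddTorus (Fin 4) => U y - m₀)
    (Fin.cons (Prod.fst mm) (Prod.snd mm) : Fin 4 → ℤ))
-- NOTATION END

/-! ## §A⁶ Bookkeeping for lattice families with rapidly decaying extension -/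

section Bookkeeping

variable {c : ℤ × (Fin 3 → ℤ) → EuclideanSpace ℂ (Fin 3)}

/-- `(𝐄 c) (Fin.cons n k) = c (n, k)`. [folklore] -/
theorem ext_cons (c : ℤ × (Fin 3 → ℤ) → EuclideanSpace ℂ (Fin 3)) (m : ℤ × (Fin 3 → ℤ)) :
    (𝐄 c) (Fin.cons m.1 m.2) = c m := by
  simp only [Fin.cons_zero, Fin.tail_cons, Prod.mk.eta]

/-- The extension of a conjugate-symmetric family is conjugate symmetric. [folklore] -/
theorem ext_neg_eq_conjVec (hcs : ∀ m, c (-m) = conjVec (c m)) (K : Fin 4 → ℤ) :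
    (𝐄 c) (-K) = conjVec ((𝐄 c) K) :=
  hcs (K 0, Fin.tail K)

/-- Summability of a lattice family with rapidly decaying extension. [folklore] -/
theorem summable_norm_of_rapidDecayE (hcr : RapidDecay (𝐄 c)) : Summable fun m : ℤ × (Fin 3 → ℤ) => ‖c m‖ := by
  have h := (summable_cons_iff (fun K : Fin 4 → ℤ => ‖(𝐄 c) K‖)).2 hcr.summable_norm
  simpa only [ext_cons] using h

/-- Weighted bound `⟨k⟩ ‖c(n,k)‖ ≤ M` of a lattice family with rapidly decaying extension. [folklore] -/
theorem weight_norm_le_of_rapidDecayE (hcr : RapidDecay (𝐄 c)) :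
    ∃ M : ℝ, ∀ l : ℤ × (Fin 3 → ℤ), sobolevWeight 1 l.2 * ‖c l‖ ≤ M := by
  have hs := hcr 1
  set T : ℝ := ∑' K : Fin 4 → ℤ, (1 + freqNormSq K) ^ 1 * ‖(𝐄 c) K‖ with hT
  have hnn : ∀ K : Fin 4 → ℤ, 0 ≤ (1 + freqNormSq K) ^ 1 * ‖(𝐄 c) K‖ := fun K =>
    mul_nonneg (one_add_freqNormSq_pow_nonneg K _) (norm_nonneg _)
  refine ⟨T, fun l => ?_⟩
  have hle : (1 + freqNormSq (Fin.cons l.1 l.2 : Fin 4 → ℤ)) ^ 1 * ‖(𝐄 c) (Fin.cons l.1 l.2)‖ ≤ T :=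
    hs.le_tsum (Fin.cons l.1 l.2) fun K' _ => hnn K'
  rw [ext_cons, pow_one] at hle
  refine le_trans (mul_le_mul_of_nonneg_right ?_ (norm_nonneg _)) hle
  rw [freqNormSq_cons, sobolevWeight]
  have hb := freqNormSq_nonneg l.2
  calc (1 + freqNormSq l.2) ^ ((1 : ℝ) / 2) ≤ (1 + freqNormSq l.2) ^ (1 : ℝ) :=
        Real.rpow_le_rpow_of_exponent_le (by linarith) (by norm_num)
    _ = 1 + freqNormSq l.2 := Real.rpow_one _
    _ ≤ 1 + (((l.1 : ℤ) : ℝ) ^ 2 + freqNormSq l.2) := by nlinarith [sq_nonneg ((l.1 : ℤ) : ℝ)]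

/-- The symbol vanishes on the zero spatial modes for transversal `a` (rapidly decaying data). [folklore] -/
theorem nl_cons_zero_of_rapidDecayE {a b : ℤ × (Fin 3 → ℤ) → EuclideanSpace ℂ (Fin 3)}
    (hat : ∀ m' : ℤ × (Fin 3 → ℤ), (∑ jj : Fin 3, ((m'.2 jj : ℤ) : ℂ) * (a m') jj) = 0)
    (har : RapidDecay (𝐄 a)) (hbr : RapidDecay (𝐄 b)) (n : ℤ) :
    𝐍[a, b] ((n, 0) : ℤ × (Fin 3 → ℤ)) = 0 := by
  obtain ⟨M, hM⟩ := weight_norm_le_of_rapidDecayE hbr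
  exact nl_zero_of_transversal a b n hat fun j p =>
    summable_nl_term_of_summable (summable_norm_of_rapidDecayE har) hM _ j p

/-- The symbol terms are summable for rapidly decaying data (bookkeeping for `nl_add_*`). [folklore] -/
theorem summable_nl_term_of_rapidDecayE {a b : ℤ × (Fin 3 → ℤ) → EuclideanSpace ℂ (Fin 3)}
    (har : RapidDecay (𝐄 a)) (hbr : RapidDecay (𝐄 b)) (m : ℤ × (Fin 3 → ℤ)) (j p : Fin 3) :
    Summable fun m' : ℤ × (Fin 3 → ℤ) => a m' j * (dsym j (m.2 - m'.2) * b (m - m') p) := by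
  obtain ⟨M, hM⟩ := weight_norm_le_of_rapidDecayE hbr
  exact summable_nl_term_of_summable (summable_norm_of_rapidDecayE har) hM m j p

/-- Pulling back a smooth function on `T³` along `Fin.tail` gives a smooth function on `T⁴`. [folklore] -/
theorem isSmooth_comp_tail {F' : Type*} [NormedAddCommGroup F'] [NormedSpace ℝ F'] {g : UnitAddTorus (Fin 3) → F'}
    (hg : IsSmooth g) : IsSmooth (fun y : UnitAddTorus (Fin 4) => g (Fin.tail y)) :=
  isSmooth_timeRoll (τ := 1) (isSmoothSpaceTimeOn_const hg univ) (fun _ => rfl)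

/-- Products of smooth complex scalar and smooth `ℂ³`-valued functions are smooth. [folklore] -/
theorem isSmooth_smul_complex {θ : UnitAddTorus (Fin 4) → ℂ} {g : UnitAddTorus (Fin 4) → EuclideanSpace ℂ (Fin 3)}
    (hθ : IsSmooth θ) (hg : IsSmooth g) : IsSmooth (fun y => θ y • g y) :=
  ContDiff.smul hθ hg

/-- Transported products of smooth fields are smooth. [folklore] -/
theorem isSmooth_transport {A W : UnitAddTorus (Fin 4) → EuclideanSpace ℂ (Fin 3)} (hA : IsSmooth A) (hW : IsSmooth W) :
    IsSmooth (fun y => ∑ j : Fin 3, (A y) j • Torus.partialDeriv (Fin.succ j) W y) :=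
  isSmooth_fun_finsetSum _ fun j _ => isSmooth_smul_complex (isSmooth_apply hA j) (hW.partialDeriv _)

/-- A `ℂ³`-valued function with smooth components is smooth. [folklore] -/
theorem isSmooth_toLp {g : Fin 3 → UnitAddTorus (Fin 4) → ℂ} (hg : ∀ i, IsSmooth (g i)) :
    IsSmooth (fun y => (WithLp.toLp 2 (fun i => g i y) : EuclideanSpace ℂ (Fin 3))) := by
  have h : ContDiff ℝ (⊤ : ℕ∞)
      (fun z : EuclideanSpace ℝ (Fin 4) => (WithLp.toLp 2 (fun i => lift (g i) z) : EuclideanSpace ℂ (Fin 3))) := by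
    exact contDiff_piLp' 2 fun i => hg i
  exact h

end Bookkeeping

/-! ## §B⁶ Pressure reconstruction -/

section Pressure

/-- **Pressure reconstruction on `T⁴`**: a smooth `ℂ³`-valued field whose space–time Fourier
coefficients vanish on the zero spatial modes and are killed by the Leray multiplier off them
is a spatial gradient `∇ₓQ` of a smooth scalar (`Q̂ = k·Φ̂ / (2πi|k|²)`). [folklore] -/
theorem exists_pressure {Φ : UnitAddTorus (Fin 4) → EuclideanSpace ℂ (Fin 3)} (hΦ : IsSmooth Φ)
    (h0 : ∀ n : ℤ, mFourierCoeff Φ (Fin.cons n 0) = 0)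
    (hP : ∀ (n : ℤ) (k : Fin 3 → ℤ), k ≠ 0 → Torus.lerayCoeff k (mFourierCoeff Φ (Fin.cons n k)) = 0) :
    ∃ Q : UnitAddTorus (Fin 4) → ℂ, IsSmooth Q ∧
      ∀ y, Φ y = WithLp.toLp 2 (fun i : Fin 3 => Torus.partialDeriv (Fin.succ i) Q y) := by
  set P : (Fin 4 → ℤ) → ℂ := fun K =>
    (∑ jj : Fin 3, ((Fin.tail K jj : ℤ) : ℂ) * (mFourierCoeff Φ K) jj) /
      (2 * Real.pi * Complex.I * ((freqNormSq (Fin.tail K) : ℝ) : ℂ)) with hPdef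
  have hΦr : RapidDecay (mFourierCoeff Φ) := hΦ.rapidDecay_mFourierCoeff
  -- `‖P K‖ ≤ ‖Φ̂ K‖`
  have hPle : ∀ K, ‖P K‖ ≤ ‖mFourierCoeff Φ K‖ := by
    intro K
    by_cases hk : Fin.tail K = 0
    · have : P K = 0 := by
        simp only [hPdef, hk, Pi.zero_apply, Int.cast_zero, zero_mul, Finset.sum_const_zero, zero_div]
      rw [this, norm_zero]; exact norm_nonneg _
    · have hb : 1 ≤ freqNormSq (Fin.tail K) := Torus.one_le_freqNormSq hk
      have hden : ‖(2 * Real.pi * Complex.I * ((freqNormSq (Fin.tail K) : ℝ) : ℂ) : ℂ)‖ =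
          2 * Real.pi * freqNormSq (Fin.tail K) := by
        rw [norm_mul, Complex.norm_real, Real.norm_of_nonneg (by linarith)]
        simp [abs_of_pos Real.pi_pos]
      rw [hPdef]
      simp only
      rw [norm_div, hden, div_le_iff₀ (by positivity)]
      have h1 := SteadyLattice.norm_kdot_le (Fin.tail K) (mFourierCoeff Φ K)
      have h2 : sobolevWeight 1 (Fin.tail K) ≤ 2 * freqNormSq (Fin.tail K) := by
        rw [sobolevWeight]
        calc (1 + freqNormSq (Fin.tail K)) ^ ((1 : ℝ) / 2) ≤ (1 + freqNormSq (Fin.tail K)) ^ (1 : ℝ) :=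
              Real.rpow_le_rpow_of_exponent_le (by linarith) (by norm_num)
          _ = 1 + freqNormSq (Fin.tail K) := Real.rpow_one _
          _ ≤ 2 * freqNormSq (Fin.tail K) := by linarith
      have h3 : (3 : ℝ) ≤ Real.pi := by linarith [Real.pi_gt_three]
      have hn := norm_nonneg (mFourierCoeff Φ K)
      calc ‖∑ jj : Fin 3, ((Fin.tail K jj : ℤ) : ℂ) * (mFourierCoeff Φ K) jj‖
          ≤ 3 * sobolevWeight 1 (Fin.tail K) * ‖mFourierCoeff Φ K‖ := h1
        _ ≤ 3 * (2 * freqNormSq (Fin.tail K)) * ‖mFourierCoeff Φ K‖ := by gcongr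
        _ ≤ Real.pi * (2 * freqNormSq (Fin.tail K)) * ‖mFourierCoeff Φ K‖ := by gcongr
        _ = ‖mFourierCoeff Φ K‖ * (2 * Real.pi * freqNormSq (Fin.tail K)) := by ring
  have hPr : RapidDecay P := fun N =>
    Summable.of_nonneg_of_le (fun K => mul_nonneg (one_add_freqNormSq_pow_nonneg K N) (norm_nonneg _))
      (fun K => mul_le_mul_of_nonneg_left (hPle K) (one_add_freqNormSq_pow_nonneg K N)) (hΦr N)
  set Q : UnitAddTorus (Fin 4) → ℂ := fourierSynth P with hQdef
  have hQ : IsSmooth Q := hPr.isSmooth_fourierSynth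
  have hQc : ∀ K, mFourierCoeff Q K = P K := hPr.mFourierCoeff_fourierSynth
  refine ⟨Q, hQ, ?_⟩
  -- the gradient field and its coefficients
  set Γ : UnitAddTorus (Fin 4) → EuclideanSpace ℂ (Fin 3) :=
    fun y => WithLp.toLp 2 (fun i : Fin 3 => Torus.partialDeriv (Fin.succ i) Q y) with hΓ
  have hΓs : IsSmooth Γ := isSmooth_toLp fun i => hQ.partialDeriv _
  have hcoef : ∀ K, mFourierCoeff Φ K = mFourierCoeff Γ K := by
    intro K
    rw [← Fin.cons_self_tail K, hΓ, mFourierCoeff_gradX_cons hQ, hQc]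
    by_cases hk : Fin.tail K = 0
    · rw [hk, h0]
      have : Torus.freqVec (0 : Fin 3 → ℤ) = 0 := by ext i; simp [Torus.freqVec_apply]
      rw [this, smul_zero]
    · have hf : ((freqNormSq (Fin.tail K) : ℝ) : ℂ) ≠ 0 := by
        exact_mod_cast ne_of_gt (lt_of_lt_of_le one_pos (Torus.one_le_freqNormSq hk))
      have h2 : (2 * Real.pi * Complex.I : ℂ) ≠ 0 := by simp [Real.pi_ne_zero]
      have hsub := SteadyLattice.sub_lerayCoeff hk (mFourierCoeff Φ (Fin.cons (K 0) (Fin.tail K)))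
      rw [hP _ _ hk, sub_zero] at hsub
      conv_lhs => rw [hsub]
      congr 1
      simp only [hPdef, Fin.cons_self_tail]
      field_simp
  intro y
  rw [hΦ.ext_mFourierCoeff hΓs hcoef]

end Pressure

/-! ## §C⁶ Nonlinear realization -/

section Nonlinear

/-- Partial derivatives ignore additive constants (left). [folklore] -/
theorem partialDeriv_const_add {F' : Type*} [NormedAddCommGroup F'] [NormedSpace ℝ F'] {d : Type*} [Fintype d] [DecidableEq d]
    (c : F') (g : UnitAddTorus d → F') (j : d) (x : UnitAddTorus d) :
    Torus.partialDeriv j (fun y => c + g y) x = Torus.partialDeriv j g x := by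
  simp only [Torus.partialDeriv, Torus.lineDeriv, deriv_const_add]

/-- **From the rolled-up identity to a classical periodic solution** (the converse dictionary of
`TimePeriodicNSLatticeOrbit`, §C): if `om ∂₀U = ν ΔₓU − (U·∇ₓ)U − ∇ₓQ + F∘tail` and
`div_x U = 0` on `T⁴` with `om > 0`, then `u(t,x) = U(omt, x)`, `p(t,x) = Q(omt, x)` is a classical
`om⁻¹`-periodic solution with force `F`. [folklore] -/
theorem classical_of_rolledUp {ν om : ℝ} (hom : 0 < om) {U : UnitAddTorus (Fin 4) → EuclideanSpace ℝ (Fin 3)}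
    {Q : UnitAddTorus (Fin 4) → ℝ} {F : UnitAddTorus (Fin 3) → EuclideanSpace ℝ (Fin 3)} (hU : IsSmooth U) (hQ : IsSmooth Q)
    (hE : ∀ y, om • Torus.partialDeriv 0 U y =
      ν • (∑ i : Fin 3, Torus.partialDeriv (Fin.succ i) (Torus.partialDeriv (Fin.succ i) U) y) -
        (∑ j : Fin 3, (U y) j • Torus.partialDeriv (Fin.succ j) U y) -
        WithLp.toLp 2 (fun i : Fin 3 => Torus.partialDeriv (Fin.succ i) Q y) + F (Fin.tail y))
    (hdiv : ∀ y, ∑ i : Fin 3, Torus.partialDeriv (Fin.succ i) (fun z => U z i) y = 0) :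
    Torus.IsClassicalNSSolutionOn univ ν (fun _ => F)
        (fun t : ℝ => fun x : UnitAddTorus (Fin 3) => U (Fin.cons (((om * t : ℝ)) : UnitAddCircle) x))
        (fun t : ℝ => fun x : UnitAddTorus (Fin 3) => Q (Fin.cons (((om * t : ℝ)) : UnitAddCircle) x)) ∧
      Function.Periodic (fun t : ℝ => fun x : UnitAddTorus (Fin 3) => U (Fin.cons (((om * t : ℝ)) : UnitAddCircle) x)) om⁻¹ := by
  set u' : ℝ → UnitAddTorus (Fin 3) → EuclideanSpace ℝ (Fin 3) :=
    fun t x => U (Fin.cons (((om * t : ℝ)) : UnitAddCircle) x) with hu'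
  set p' : ℝ → UnitAddTorus (Fin 3) → ℝ := fun t x => Q (Fin.cons (((om * t : ℝ)) : UnitAddCircle) x) with hp'
  have hper : Function.Periodic u' om⁻¹ := periodic_comp_cons U hom.ne'
  have hroll : timeRoll om⁻¹ u' = U := timeRoll_comp_cons U hom.ne'
  have hsu : IsSmoothSpaceTimeOn univ u' := isSmoothSpaceTimeOn_cons hU om
  have hsp : IsSmoothSpaceTimeOn univ p' := isSmoothSpaceTimeOn_cons hQ om
  refine ⟨⟨hsu, hsp, fun t _ x => ?_, fun t _ x => ?_⟩, hper⟩
  · -- momentum at `(t, x)`, read at `y = (omt, x)`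
    have h0 := partialDeriv_zero_timeRoll hsu hper (om * t) x
    rw [hroll, show om⁻¹ * (om * t) = t by field_simp] at h0
    have hy := hE (Fin.cons (((om * t : ℝ)) : UnitAddCircle) x)
    rw [h0, smul_smul, mul_inv_cancel₀ hom.ne', one_smul, ← laplacian_timeSlice hU, ← convect_timeSlice hU,
      Fin.tail_cons] at hy
    have hg : Torus.gradient (timeSlice Q (((om * t : ℝ)) : UnitAddCircle)) x =
        WithLp.toLp 2 (fun i : Fin 3 => Torus.partialDeriv (Fin.succ i) Q (Fin.cons (((om * t : ℝ)) : UnitAddCircle) x)) := by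
      ext i; rw [gradient_timeSlice_apply hQ]
    rw [← hg] at hy
    change timeDerivWithin univ u' t x + Torus.convect (timeSlice U (((om * t : ℝ)) : UnitAddCircle))
        (timeSlice U (((om * t : ℝ)) : UnitAddCircle)) x =
      ν • Torus.laplacian (timeSlice U (((om * t : ℝ)) : UnitAddCircle)) x -
        Torus.gradient (timeSlice Q (((om * t : ℝ)) : UnitAddCircle)) x + F x
    rw [hy]; abel
  · change Torus.divergence (timeSlice U (((om * t : ℝ)) : UnitAddCircle)) x = 0
    rw [divergence_timeSlice]
    exact hdiv _

variable {ν om : ℝ} {m₀ : EuclideanSpace ℝ (Fin 3)} {F : UnitAddTorus (Fin 3) → EuclideanSpace ℝ (Fin 3)}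
  {c : ℤ × (Fin 3 → ℤ) → EuclideanSpace ℂ (Fin 3)}

/-- **Divergence of a real synthesis**: if the lattice family `c` is transversal then the real
field `m₀ + Re F_{𝐄 c}` is divergence free in the spatial variables. [folklore] -/
theorem div_realSynth_eq_zero (hct : ∀ m : ℤ × (Fin 3 → ℤ), (∑ jj : Fin 3, ((m.2 jj : ℤ) : ℂ) * (c m) jj) = 0)
    (hcs : ∀ m, c (-m) = conjVec (c m)) (hcr : RapidDecay (𝐄 c)) (y : UnitAddTorus (Fin 4)) :
    ∑ i : Fin 3, Torus.partialDeriv (Fin.succ i) (fun z => (m₀ + EuclideanSpace.realPart (fourierSynth (𝐄 c) z)) i) y = 0 := by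
  obtain ⟨hV's, hVreal, hVcoef⟩ := realSynth_spec' hcr (ext_neg_eq_conjVec hcs)
  have hVi : ∀ i, IsSmooth (fun z => (((EuclideanSpace.realPart (fourierSynth (𝐄 c) z)) i : ℝ) : ℂ)) := isSmooth_ofReal_apply hV's
  -- the complexified divergence has vanishing coefficients
  set Dc : UnitAddTorus (Fin 4) → ℂ := fun z => ∑ i : Fin 3,
    Torus.partialDeriv (Fin.succ i) (fun w => (((EuclideanSpace.realPart (fourierSynth (𝐄 c) w)) i : ℝ) : ℂ)) z with hDc
  have hDcc : Continuous Dc := continuous_finsetSum _ fun i _ => ((hVi i).partialDeriv _).continuous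
  have hDc0 : Dc = 0 := by
    refine eq_zero_of_forall_mFourierCoeff_eq_zero hDcc fun K => ?_
    rw [hDc, mFourierCoeff_finset_sum Finset.univ (fun i _ => ((hVi i).partialDeriv _).integrable)]
    rw [← Fin.cons_self_tail K]
    simp_rw [mFourierCoeff_partialDeriv (hVi _) (Fin.succ _) (Fin.cons (K 0) (Fin.tail K)), Fin.cons_succ, smul_eq_mul,
      mFourierCoeff_ofReal_apply hV's, hVcoef]
    have := hct (K 0, Fin.tail K)
    calc ∑ x : Fin 3, 2 * Real.pi * Complex.I * ((Fin.tail K x : ℤ) : ℂ) * ((𝐄 c) (Fin.cons (K 0) (Fin.tail K))) x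
        = 2 * Real.pi * Complex.I * ∑ jj : Fin 3, ((Fin.tail K jj : ℤ) : ℂ) * (c (K 0, Fin.tail K)) jj := by
          rw [Finset.mul_sum]
          refine Finset.sum_congr rfl fun jj _ => ?_
          rw [ext_cons c (K 0, Fin.tail K)]; ring
      _ = 0 := by rw [this, mul_zero]
  have hreal : ∀ i, Torus.partialDeriv (Fin.succ i) (fun z => (m₀ + EuclideanSpace.realPart (fourierSynth (𝐄 c) z)) i) y =
      Torus.partialDeriv (Fin.succ i) (fun z => (EuclideanSpace.realPart (fourierSynth (𝐄 c) z)) i) y := by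
    intro i
    have : (fun z => (m₀ + EuclideanSpace.realPart (fourierSynth (𝐄 c) z)) i) =
        fun z => m₀ i + (fun w => (EuclideanSpace.realPart (fourierSynth (𝐄 c) w)) i) z := by funext z; simp
    rw [this, partialDeriv_const_add]
  rw [Finset.sum_congr rfl fun i _ => hreal i]
  have h := congrArg (fun g : UnitAddTorus (Fin 4) → ℂ => g y) hDc0
  simp only [hDc, Pi.zero_apply] at h
  simp_rw [partialDeriv_ofReal_apply hV's] at h
  exact_mod_cast h

/-- **The rolled-up identity of a lattice solution** (nonlinear case): if the real smooth field
`V'` on `T⁴` has coefficients `𝐄 c` where `c` (zero spatial modes vanishing, transversal, with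
rapidly decaying extension) solves the projected lattice equation with frequency `ω`, drift
`m₀` and force `F` (smooth, divergence free, mean zero), then for a smooth real `Q`
`ω ∂₀V' = ν ΔₓV' − ((m₀ + V')·∇ₓ)V' − ∇ₓQ + F∘tail` on `T⁴`. [folklore] -/
theorem rolledUp_of_coeff {V' : UnitAddTorus (Fin 4) → EuclideanSpace ℝ (Fin 3)} (hV's : IsSmooth V')
    (hVcoef : ∀ K, mFourierCoeff (complexify ∘ V') K = (𝐄 c) K)
    (hF : IsSmooth F) (hFdiv : IsDivFree F) (hF0 : HasZeroMean F) (hc0 : ∀ n : ℤ, c (n, 0) = 0)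
    (hct : ∀ m : ℤ × (Fin 3 → ℤ), (∑ jj : Fin 3, ((m.2 jj : ℤ) : ℂ) * (c m) jj) = 0) (hcr : RapidDecay (𝐄 c))
    (heq : ∀ m : ℤ × (Fin 3 → ℤ), m.2 ≠ 0 →
      (2 * Real.pi * Complex.I * (om : ℂ) * (m.1 : ℂ) + ((4 * Real.pi ^ 2 * ν * freqNormSq m.2 : ℝ) : ℂ) +
          2 * Real.pi * Complex.I * (∑ jj : Fin 3, ((m₀ jj : ℝ) : ℂ) * ((m.2 jj : ℤ) : ℂ))) • c m +
        Torus.lerayCoeff m.2 (𝐍[c, c] m) = if m.1 = 0 then mFourierCoeff (complexify ∘ F) m.2 else 0) :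
    ∃ Q : UnitAddTorus (Fin 4) → ℝ, IsSmooth Q ∧ ∀ y,
      om • Torus.partialDeriv 0 V' y =
        ν • (∑ i : Fin 3, Torus.partialDeriv (Fin.succ i) (Torus.partialDeriv (Fin.succ i) V') y) -
          (∑ j : Fin 3, (m₀ j + (V' y) j) • Torus.partialDeriv (Fin.succ j) V' y) -
          WithLp.toLp 2 (fun i : Fin 3 => Torus.partialDeriv (Fin.succ i) Q y) + F (Fin.tail y) := by
  have hVc : IsSmooth (complexify ∘ V') := hV's.comp_clm complexify.toContinuousLinearMap
  have hFc' : IsSmooth (complexify ∘ F) := hF.comp_clm complexify.toContinuousLinearMap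
  have hLc : 𝐋 (mFourierCoeff (complexify ∘ V')) = c := by
    funext m; rw [hVcoef]; exact ext_cons c m
  -- derivative relations
  have hd1 : ∀ j z, Torus.partialDeriv j (complexify ∘ V') z = complexify (Torus.partialDeriv j V' z) := by
    intro j z
    have h := partialDeriv_clm_comp hV's complexify.toContinuousLinearMap j z
    simpa only [LinearIsometry.coe_toContinuousLinearMap] using h
  have hd1' : ∀ j, Torus.partialDeriv j (complexify ∘ V') = complexify ∘ Torus.partialDeriv j V' :=
    fun j => funext (hd1 j)
  have hd2 : ∀ i j z, Torus.partialDeriv i (Torus.partialDeriv j (complexify ∘ V')) z =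
      complexify (Torus.partialDeriv i (Torus.partialDeriv j V') z) := by
    intro i j z
    rw [hd1' j]
    have h := partialDeriv_clm_comp (hV's.partialDeriv j) complexify.toContinuousLinearMap i z
    simpa only [LinearIsometry.coe_toContinuousLinearMap] using h
  -- the five fields of the complex residual
  set Vc : UnitAddTorus (Fin 4) → EuclideanSpace ℂ (Fin 3) := complexify ∘ V' with hVcdef
  set L : UnitAddTorus (Fin 4) → EuclideanSpace ℂ (Fin 3) :=
    fun y => ∑ i : Fin 3, Torus.partialDeriv (Fin.succ i) (Torus.partialDeriv (Fin.succ i) Vc) y with hL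
  set D : UnitAddTorus (Fin 4) → EuclideanSpace ℂ (Fin 3) :=
    fun y => ∑ j : Fin 3, ((m₀ j : ℝ) : ℂ) • Torus.partialDeriv (Fin.succ j) Vc y with hD
  set T : UnitAddTorus (Fin 4) → EuclideanSpace ℂ (Fin 3) :=
    fun y => ∑ j : Fin 3, (Vc y) j • Torus.partialDeriv (Fin.succ j) Vc y with hT
  set E₀ : UnitAddTorus (Fin 4) → EuclideanSpace ℂ (Fin 3) := fun y => (om : ℂ) • Torus.partialDeriv 0 Vc y with hE₀
  set Fc : UnitAddTorus (Fin 4) → EuclideanSpace ℂ (Fin 3) := fun y => (complexify ∘ F) (Fin.tail y) with hFcdef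
  have hLs : IsSmooth L := isSmooth_fun_finsetSum _ fun i _ => (hVc.partialDeriv _).partialDeriv _
  have hDs : IsSmooth D :=
    isSmooth_fun_finsetSum _ fun j _ => isSmooth_smul_complex (isSmooth_const _) (hVc.partialDeriv _)
  have hTs : IsSmooth T := isSmooth_transport hVc hVc
  have hE₀s : IsSmooth E₀ := isSmooth_smul_complex (isSmooth_const _) (hVc.partialDeriv 0)
  have hFcs : IsSmooth Fc := isSmooth_comp_tail hFc'
  set Φ : UnitAddTorus (Fin 4) → EuclideanSpace ℂ (Fin 3) :=
    fun y => (1 : ℂ) • ((ν : ℂ) • L y - D y - T y - E₀ y + Fc y) with hΦ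
  have hΦs : IsSmooth Φ := by
    have h : IsSmooth (fun y => (ν : ℂ) • L y - D y - T y - E₀ y + Fc y) :=
      ((((isSmooth_smul_complex (isSmooth_const _) hLs).sub hDs).sub hTs).sub hE₀s).add hFcs
    exact isSmooth_smul_complex (isSmooth_const (1 : ℂ)) h
  -- coefficients of `Φ`
  have cΦ : ∀ m : ℤ × (Fin 3 → ℤ), mFourierCoeff Φ (Fin.cons m.1 m.2) =
      (ν : ℂ) • ((((-(4 * Real.pi ^ 2 * freqNormSq m.2)) : ℝ) : ℂ) • c m) -
        (2 * Real.pi * Complex.I * (∑ jj : Fin 3, ((m₀ jj : ℝ) : ℂ) * ((m.2 jj : ℤ) : ℂ))) • c m -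
        𝐍[c, c] m - (om : ℂ) • ((2 * Real.pi * Complex.I * (m.1 : ℂ)) • c m) +
        (if m.1 = 0 then mFourierCoeff (complexify ∘ F) m.2 else 0) := by
    intro m
    have hv : mFourierCoeff Vc (Fin.cons m.1 m.2) = c m := by rw [hVcoef]; exact ext_cons c m
    have cL : mFourierCoeff L (Fin.cons m.1 m.2) = (((-(4 * Real.pi ^ 2 * freqNormSq m.2)) : ℝ) : ℂ) • c m := by
      rw [mFourierCoeff_laplacianX_cons hVc, hv]
    have cD : mFourierCoeff D (Fin.cons m.1 m.2) =
        (2 * Real.pi * Complex.I * (∑ jj : Fin 3, ((m₀ jj : ℝ) : ℂ) * ((m.2 jj : ℤ) : ℂ))) • c m := by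
      have hint : ∀ j : Fin 3, Integrable (fun y => ((m₀ j : ℝ) : ℂ) • Torus.partialDeriv (Fin.succ j) Vc y) volume :=
        fun j => (((hVc.partialDeriv (Fin.succ j)).continuous.const_smul ((m₀ j : ℝ) : ℂ) :)).integrable_unitAddTorus
      rw [hD, mFourierCoeff_finset_sum Finset.univ (fun j _ => hint j)]
      have : ∀ j : Fin 3, mFourierCoeff (fun y => ((m₀ j : ℝ) : ℂ) • Torus.partialDeriv (Fin.succ j) Vc y) (Fin.cons m.1 m.2) =
          (((m₀ j : ℝ) : ℂ) * dsym j m.2) • c m := by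
        intro j
        rw [show (fun y => ((m₀ j : ℝ) : ℂ) • Torus.partialDeriv (Fin.succ j) Vc y) =
            ((m₀ j : ℝ) : ℂ) • Torus.partialDeriv (Fin.succ j) Vc from rfl, mFourierCoeff_const_smul,
          mFourierCoeff_partialDeriv_succ_cons hVc, hv, smul_smul]
      simp_rw [this, ← Finset.sum_smul]
      congr 1
      rw [Finset.mul_sum]
      refine Finset.sum_congr rfl fun j _ => ?_
      rw [dsym_apply]; ring
    have cT : mFourierCoeff T (Fin.cons m.1 m.2) = 𝐍[c, c] m := by
      rw [hT, mFourierCoeff_transport_cons hVc hVc, hLc]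
    have cE : mFourierCoeff E₀ (Fin.cons m.1 m.2) = (om : ℂ) • ((2 * Real.pi * Complex.I * (m.1 : ℂ)) • c m) := by
      rw [show E₀ = (om : ℂ) • Torus.partialDeriv 0 Vc from rfl, mFourierCoeff_const_smul,
        mFourierCoeff_partialDeriv_zero_cons hVc, hv]
    have cF : mFourierCoeff Fc (Fin.cons m.1 m.2) = if m.1 = 0 then mFourierCoeff (complexify ∘ F) m.2 else 0 :=
      mFourierCoeff_comp_tail hFc'.continuous m.1 m.2
    rw [hΦ, mFourierCoeff_lincomb hLs.integrable hDs.integrable hTs.integrable hE₀s.integrable hFcs.integrable,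
      one_smul, cL, cD, cT, cE, cF]
  -- zero spatial modes of `Φ` vanish
  have hF00 : mFourierCoeff (complexify ∘ F) 0 = 0 := SteadyLattice.mFourierCoeff_complexify_zero_of_hasZeroMean hF hF0
  have h0' : ∀ n : ℤ, mFourierCoeff Φ (Fin.cons n 0) = 0 := by
    intro n
    rw [show (Fin.cons n 0 : Fin 4 → ℤ) = Fin.cons ((n, (0 : Fin 3 → ℤ)) : ℤ × (Fin 3 → ℤ)).1
      ((n, (0 : Fin 3 → ℤ)) : ℤ × (Fin 3 → ℤ)).2 from rfl, cΦ, nl_cons_zero_of_rapidDecayE hct hcr hcr n]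
    simp only [hc0 n, smul_zero, hF00, ite_self, add_zero, sub_self]
  -- the Leray multiplier kills the coefficients of `Φ` off the zero modes
  have hP' : ∀ (n : ℤ) (k : Fin 3 → ℤ), k ≠ 0 → Torus.lerayCoeff k (mFourierCoeff Φ (Fin.cons n k)) = 0 := by
    intro n k hk
    rw [show (Fin.cons n k : Fin 4 → ℤ) = Fin.cons ((n, k) : ℤ × (Fin 3 → ℤ)).1 ((n, k) : ℤ × (Fin 3 → ℤ)).2 from rfl, cΦ]
    have he := heq (n, k) hk
    let P : EuclideanSpace ℂ (Fin 3) →ₗ[ℂ] EuclideanSpace ℂ (Fin 3) :=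
      { toFun := Torus.lerayCoeff k, map_add' := SteadyLattice.lerayCoeff_add' k,
        map_smul' := SteadyLattice.lerayCoeff_smul' k }
    have hPw : ∀ w, P w = Torus.lerayCoeff k w := fun w => rfl
    have Pv : Torus.lerayCoeff k (c (n, k)) = c (n, k) := SteadyLattice.lerayCoeff_of_kdot_eq_zero hk (hct (n, k))
    set Fn : EuclideanSpace ℂ (Fin 3) := (if ((n, k) : ℤ × (Fin 3 → ℤ)).1 = 0 then
      mFourierCoeff (complexify ∘ F) ((n, k) : ℤ × (Fin 3 → ℤ)).2 else 0) with hFn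
    have PF : Torus.lerayCoeff k Fn = Fn := by
      rw [hFn]
      split_ifs
      · exact SteadyLattice.lerayCoeff_of_kdot_eq_zero hk (hFdiv.sum_mul_mFourierCoeff_eq_zero hF k)
      · exact SteadyLattice.lerayCoeff_zero_vec k
    set N : EuclideanSpace ℂ (Fin 3) := Torus.lerayCoeff k (𝐍[c, c] (n, k)) with hN
    rw [← hPw]
    simp only [map_smul, map_sub, map_add]
    simp only [hPw, Pv, PF]
    change _ - _ - N - _ + Fn = 0
    change _ + N = Fn at he
    ext i
    have hi := congrArg (fun w : EuclideanSpace ℂ (Fin 3) => w i) he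
    simp only [PiLp.add_apply, PiLp.sub_apply, PiLp.smul_apply, smul_eq_mul, PiLp.zero_apply] at hi ⊢
    push_cast at hi ⊢
    linear_combination (-1 : ℂ) * hi
  obtain ⟨Q, hQs, hΦQ⟩ := exists_pressure hΦs h0' hP'
  have hQr : IsSmooth (fun y => (Q y).re) := hQs.comp_clm Complex.reCLM
  refine ⟨fun y => (Q y).re, hQr, fun y => ?_⟩
  -- the pieces of the residual are complexifications
  have pL : L y = complexify (∑ i : Fin 3, Torus.partialDeriv (Fin.succ i) (Torus.partialDeriv (Fin.succ i) V') y) := by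
    rw [hL, map_sum]
    exact Finset.sum_congr rfl fun i _ => hd2 _ _ y
  have pD : D y = complexify (∑ j : Fin 3, (m₀ j) • Torus.partialDeriv (Fin.succ j) V' y) := by
    rw [hD, map_sum]
    refine Finset.sum_congr rfl fun j _ => ?_
    rw [hd1, LinearIsometry.map_smul, Complex.coe_smul]
  have pT : T y = complexify (∑ j : Fin 3, ((V' y) j) • Torus.partialDeriv (Fin.succ j) V' y) := by
    rw [hT, map_sum]
    refine Finset.sum_congr rfl fun j _ => ?_
    rw [hd1, LinearIsometry.map_smul, hVcdef, Function.comp_apply, complexify_apply, Complex.coe_smul]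
  have pE : E₀ y = complexify (om • Torus.partialDeriv 0 V' y) := by
    show (om : ℂ) • Torus.partialDeriv 0 Vc y = _
    rw [LinearIsometry.map_smul, hd1, Complex.coe_smul]
  have pG : EuclideanSpace.realPart (WithLp.toLp 2 (fun i : Fin 3 => Torus.partialDeriv (Fin.succ i) Q y)) =
      WithLp.toLp 2 (fun i : Fin 3 => Torus.partialDeriv (Fin.succ i) (fun z => (Q z).re) y) := by
    ext i
    rw [realPart_apply]
    exact (partialDeriv_clm_comp hQs Complex.reCLM (Fin.succ i) y).symm
  have hid := hΦQ y
  rw [hΦ] at hid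
  simp only [one_smul] at hid
  rw [pL, pD, pT, pE] at hid
  have h2 : complexify (ν • (∑ i : Fin 3, Torus.partialDeriv (Fin.succ i) (Torus.partialDeriv (Fin.succ i) V') y) -
      (∑ j : Fin 3, (m₀ j) • Torus.partialDeriv (Fin.succ j) V' y) -
      (∑ j : Fin 3, ((V' y) j) • Torus.partialDeriv (Fin.succ j) V' y) - om • Torus.partialDeriv 0 V' y + F (Fin.tail y)) =
      WithLp.toLp 2 (fun i : Fin 3 => Torus.partialDeriv (Fin.succ i) Q y) := by
    rw [← hid]
    simp only [map_sub, map_add, LinearIsometry.map_smul, Complex.coe_smul, hFcdef, Function.comp_apply]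
  have h3 := congrArg EuclideanSpace.realPart h2
  rw [realPart_complexify, pG] at h3
  rw [← h3]
  simp only [add_smul, Finset.sum_add_distrib]
  abel

/-- **Nonlinear realization** (Iooss 1972, §2, read backwards; Kielhöfer 2012, §I.8): a
conjugate-symmetric transversal solution `c` (zero spatial modes vanishing, rapidly decaying
extension) of the projected lattice equation with frequency `ω > 0`, drift `m₀` and a smooth
divergence-free mean-zero force `F` is the coefficient family of a classical `ω⁻¹`-periodic
solution `u(t,x) = m₀ + Re F_{𝐄 c}(ωt, x)` of the forced Navier–Stokes system. [folklore] -/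
theorem realize_nonlinear (hom : 0 < om) (hF : IsSmooth F) (hFdiv : IsDivFree F) (hF0 : HasZeroMean F)
    (hc0 : ∀ n : ℤ, c (n, 0) = 0)
    (hct : ∀ m : ℤ × (Fin 3 → ℤ), (∑ jj : Fin 3, ((m.2 jj : ℤ) : ℂ) * (c m) jj) = 0)
    (hcs : ∀ m, c (-m) = conjVec (c m)) (hcr : RapidDecay (𝐄 c))
    (heq : ∀ m : ℤ × (Fin 3 → ℤ), m.2 ≠ 0 →
      (2 * Real.pi * Complex.I * (om : ℂ) * (m.1 : ℂ) + ((4 * Real.pi ^ 2 * ν * freqNormSq m.2 : ℝ) : ℂ) +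
          2 * Real.pi * Complex.I * (∑ jj : Fin 3, ((m₀ jj : ℝ) : ℂ) * ((m.2 jj : ℤ) : ℂ))) • c m +
        Torus.lerayCoeff m.2 (𝐍[c, c] m) = if m.1 = 0 then mFourierCoeff (complexify ∘ F) m.2 else 0) :
    ∃ p' : ℝ → UnitAddTorus (Fin 3) → ℝ,
      Torus.IsClassicalNSSolutionOn univ ν (fun _ => F)
        (fun t : ℝ => fun x : UnitAddTorus (Fin 3) =>
          m₀ + EuclideanSpace.realPart (fourierSynth (𝐄 c) (Fin.cons (((om * t : ℝ)) : UnitAddCircle) x))) p' ∧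
      Function.Periodic (fun t : ℝ => fun x : UnitAddTorus (Fin 3) =>
          m₀ + EuclideanSpace.realPart (fourierSynth (𝐄 c) (Fin.cons (((om * t : ℝ)) : UnitAddCircle) x))) om⁻¹ := by
  obtain ⟨hV's, -, hVcoef⟩ := realSynth_spec' hcr (ext_neg_eq_conjVec hcs)
  obtain ⟨Q, hQ, hE⟩ := rolledUp_of_coeff hV's hVcoef hF hFdiv hF0 hc0 hct hcr heq
  have hU : IsSmooth (fun y : UnitAddTorus (Fin 4) => m₀ + EuclideanSpace.realPart (fourierSynth (𝐄 c) y)) :=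
    (isSmooth_const m₀).add hV's
  have hdU : ∀ j, Torus.partialDeriv j (fun z : UnitAddTorus (Fin 4) => m₀ + EuclideanSpace.realPart (fourierSynth (𝐄 c) z)) =
      Torus.partialDeriv j (fun z => EuclideanSpace.realPart (fourierSynth (𝐄 c) z)) :=
    fun j => funext fun z => partialDeriv_const_add m₀ _ j z
  have hE' : ∀ y, om • Torus.partialDeriv 0 (fun z : UnitAddTorus (Fin 4) => m₀ + EuclideanSpace.realPart (fourierSynth (𝐄 c) z)) y =
      ν • (∑ i : Fin 3, Torus.partialDeriv (Fin.succ i) (Torus.partialDeriv (Fin.succ i)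
        (fun z : UnitAddTorus (Fin 4) => m₀ + EuclideanSpace.realPart (fourierSynth (𝐄 c) z))) y) -
      (∑ j : Fin 3, ((m₀ + EuclideanSpace.realPart (fourierSynth (𝐄 c) y)) j) •
        Torus.partialDeriv (Fin.succ j) (fun z : UnitAddTorus (Fin 4) => m₀ + EuclideanSpace.realPart (fourierSynth (𝐄 c) z)) y) -
      WithLp.toLp 2 (fun i : Fin 3 => Torus.partialDeriv (Fin.succ i) Q y) + F (Fin.tail y) := by
    intro y
    simp only [hdU, PiLp.add_apply]
    exact hE y
  exact ⟨_, classical_of_rolledUp hom hU hQ hE' (div_realSynth_eq_zero hct hcs hcr)⟩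

end Nonlinear

/-! ## §D⁶ Linear realization -/

section Linear

variable {ν τ : ℝ} {U : UnitAddTorus (Fin 4) → EuclideanSpace ℝ (Fin 3)} {m₀ : EuclideanSpace ℝ (Fin 3)}
  {h : ℤ × (Fin 3 → ℤ) → EuclideanSpace ℂ (Fin 3)} {b : ℂ}

/-- Coefficients of a six-term linear combination (bookkeeping). [folklore] -/
theorem mFourierCoeff_lincomb₆ {f₁ f₂ f₃ f₄ f₅ f₆ : UnitAddTorus (Fin 4) → EuclideanSpace ℂ (Fin 3)}
    (h₁ : Integrable f₁ volume) (h₂ : Integrable f₂ volume) (h₃ : Integrable f₃ volume) (h₄ : Integrable f₄ volume)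
    (h₅ : Integrable f₅ volume) (h₆ : Integrable f₆ volume) (c' : ℂ) (K : Fin 4 → ℤ) :
    mFourierCoeff (fun y => c' • f₁ y - f₂ y - f₃ y - f₄ y - f₅ y + f₆ y) K =
      c' • mFourierCoeff f₁ K - mFourierCoeff f₂ K - mFourierCoeff f₃ K - mFourierCoeff f₄ K - mFourierCoeff f₅ K +
        mFourierCoeff f₆ K := by
  have e : (fun y => c' • f₁ y - f₂ y - f₃ y - f₄ y - f₅ y + f₆ y) = c' • f₁ - f₂ - f₃ - f₄ - f₅ + f₆ := by
    funext y; simp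
  rw [e, mFourierCoeff_add (((((h₁.smul c').sub h₂).sub h₃).sub h₄).sub h₅) h₆,
    mFourierCoeff_sub ((((h₁.smul c').sub h₂).sub h₃).sub h₄) h₅, mFourierCoeff_sub (((h₁.smul c').sub h₂).sub h₃) h₄,
    mFourierCoeff_sub ((h₁.smul c').sub h₂) h₃, mFourierCoeff_sub (h₁.smul c') h₂, mFourierCoeff_const_smul]

/-- `𝐄 (𝐋 C) = C`, hence rapid decay transfers. [folklore] -/
theorem rapidDecay_ext_lattice {C : (Fin 4 → ℤ) → EuclideanSpace ℂ (Fin 3)} (hC : RapidDecay C) : RapidDecay (𝐄 (𝐋 C)) := by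
  have : (𝐄 (𝐋 C)) = C := by funext K; simp only [Fin.cons_self_tail]
  rw [this]; exact hC

/-- **The rolled-up identity of a lattice solution** (linearised case): if `h` (zero spatial
modes vanishing, transversal, rapidly decaying extension) solves the linearised projected
lattice equation around the lattice data `û` of a smooth real field `U` (slice means `m₀`,
divergence free), with right-hand side `b (2πi n) û`, then for a smooth complex `Q`
`τ⁻¹ ∂₀W = ν ΔₓW − (U·∇ₓ)W − (W·∇ₓ)U − ∇ₓQ + b ∂₀U` on `T⁴`, `W = F_{𝐄 h}`. [folklore] -/
theorem linear_rolledUp_of_coeff (hU : IsSmooth U)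
    (hu0 : ∀ n : ℤ, 𝐮[U, m₀] ((n, 0) : ℤ × (Fin 3 → ℤ)) = 0)
    (hut : ∀ m : ℤ × (Fin 3 → ℤ), (∑ jj : Fin 3, ((m.2 jj : ℤ) : ℂ) * (𝐮[U, m₀] m) jj) = 0)
    (hh0 : ∀ n : ℤ, h (n, 0) = 0)
    (hht : ∀ m : ℤ × (Fin 3 → ℤ), (∑ jj : Fin 3, ((m.2 jj : ℤ) : ℂ) * (h m) jj) = 0) (hhr : RapidDecay (𝐄 h))
    (hleq : ∀ m : ℤ × (Fin 3 → ℤ), m.2 ≠ 0 →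
      (2 * Real.pi * Complex.I * ((τ⁻¹ : ℝ) : ℂ) * (m.1 : ℂ) + ((4 * Real.pi ^ 2 * ν * freqNormSq m.2 : ℝ) : ℂ) +
          2 * Real.pi * Complex.I * (∑ jj : Fin 3, ((m₀ jj : ℝ) : ℂ) * ((m.2 jj : ℤ) : ℂ))) • h m +
        Torus.lerayCoeff m.2 (𝐍[𝐮[U, m₀], h] m + 𝐍[h, 𝐮[U, m₀]] m) =
        b • ((2 * Real.pi * Complex.I * (m.1 : ℂ)) • 𝐮[U, m₀] m)) :
    ∃ Q : UnitAddTorus (Fin 4) → ℂ, IsSmooth Q ∧ ∀ y,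
      ((τ⁻¹ : ℝ) : ℂ) • Torus.partialDeriv 0 (fourierSynth (𝐄 h)) y =
        (ν : ℂ) • (∑ i : Fin 3, Torus.partialDeriv (Fin.succ i) (Torus.partialDeriv (Fin.succ i) (fourierSynth (𝐄 h))) y) -
          (∑ j : Fin 3, (((U y) j : ℝ) : ℂ) • Torus.partialDeriv (Fin.succ j) (fourierSynth (𝐄 h)) y) -
          (∑ j : Fin 3, ((fourierSynth (𝐄 h) y) j) • complexify (Torus.partialDeriv (Fin.succ j) U y)) -
          WithLp.toLp 2 (fun i : Fin 3 => Torus.partialDeriv (Fin.succ i) Q y) + b • complexify (Torus.partialDeriv 0 U y) := by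
  have hV : IsSmooth (fun y => U y - m₀) := hU.sub (isSmooth_const m₀)
  have hVc : IsSmooth (complexify ∘ fun y => U y - m₀) := hV.comp_clm complexify.toContinuousLinearMap
  have hW : IsSmooth (fourierSynth (𝐄 h)) := hhr.isSmooth_fourierSynth
  have hWc : ∀ K, mFourierCoeff (fourierSynth (𝐄 h)) K = (𝐄 h) K := hhr.mFourierCoeff_fourierSynth
  have hLh : 𝐋 (mFourierCoeff (fourierSynth (𝐄 h))) = h := by funext m; rw [hWc]; exact ext_cons h m
  have hur : RapidDecay (𝐄 (𝐮[U, m₀])) := rapidDecay_ext_lattice hVc.rapidDecay_mFourierCoeff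
  -- derivative relations for `Vc`
  have hd1 : ∀ j z, Torus.partialDeriv j (complexify ∘ fun y => U y - m₀) z = complexify (Torus.partialDeriv j U z) := by
    intro j z
    have h1 := partialDeriv_clm_comp hV complexify.toContinuousLinearMap j z
    simp only [LinearIsometry.coe_toContinuousLinearMap] at h1
    rw [h1, partialDeriv_sub_const]
  -- the six fields of the residual
  set Vc : UnitAddTorus (Fin 4) → EuclideanSpace ℂ (Fin 3) := complexify ∘ fun y => U y - m₀ with hVcdef
  set W : UnitAddTorus (Fin 4) → EuclideanSpace ℂ (Fin 3) := fourierSynth (𝐄 h) with hWdef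
  set L : UnitAddTorus (Fin 4) → EuclideanSpace ℂ (Fin 3) :=
    fun y => ∑ i : Fin 3, Torus.partialDeriv (Fin.succ i) (Torus.partialDeriv (Fin.succ i) W) y with hL
  set D : UnitAddTorus (Fin 4) → EuclideanSpace ℂ (Fin 3) :=
    fun y => ∑ j : Fin 3, ((m₀ j : ℝ) : ℂ) • Torus.partialDeriv (Fin.succ j) W y with hD
  set T₁ : UnitAddTorus (Fin 4) → EuclideanSpace ℂ (Fin 3) :=
    fun y => ∑ j : Fin 3, (Vc y) j • Torus.partialDeriv (Fin.succ j) W y with hT₁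
  set T₂ : UnitAddTorus (Fin 4) → EuclideanSpace ℂ (Fin 3) :=
    fun y => ∑ j : Fin 3, (W y) j • Torus.partialDeriv (Fin.succ j) Vc y with hT₂
  set E₀ : UnitAddTorus (Fin 4) → EuclideanSpace ℂ (Fin 3) := fun y => ((τ⁻¹ : ℝ) : ℂ) • Torus.partialDeriv 0 W y with hE₀
  set B : UnitAddTorus (Fin 4) → EuclideanSpace ℂ (Fin 3) := fun y => b • Torus.partialDeriv 0 Vc y with hB
  have hLs : IsSmooth L := isSmooth_fun_finsetSum _ fun i _ => (hW.partialDeriv _).partialDeriv _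
  have hDs : IsSmooth D :=
    isSmooth_fun_finsetSum _ fun j _ => isSmooth_smul_complex (isSmooth_const _) (hW.partialDeriv _)
  have hT₁s : IsSmooth T₁ := isSmooth_transport hVc hW
  have hT₂s : IsSmooth T₂ := isSmooth_transport hW hVc
  have hE₀s : IsSmooth E₀ := isSmooth_smul_complex (isSmooth_const _) (hW.partialDeriv 0)
  have hBs : IsSmooth B := isSmooth_smul_complex (isSmooth_const _) (hVc.partialDeriv 0)
  set Φ : UnitAddTorus (Fin 4) → EuclideanSpace ℂ (Fin 3) :=
    fun y => (ν : ℂ) • L y - D y - T₁ y - T₂ y - E₀ y + B y with hΦ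
  have hΦs : IsSmooth Φ := (((((isSmooth_smul_complex (isSmooth_const _) hLs).sub hDs).sub hT₁s).sub hT₂s).sub hE₀s).add hBs
  -- coefficients of `Φ`
  have cΦ : ∀ m : ℤ × (Fin 3 → ℤ), mFourierCoeff Φ (Fin.cons m.1 m.2) =
      (ν : ℂ) • ((((-(4 * Real.pi ^ 2 * freqNormSq m.2)) : ℝ) : ℂ) • h m) -
        (2 * Real.pi * Complex.I * (∑ jj : Fin 3, ((m₀ jj : ℝ) : ℂ) * ((m.2 jj : ℤ) : ℂ))) • h m -
        𝐍[𝐮[U, m₀], h] m - 𝐍[h, 𝐮[U, m₀]] m - ((τ⁻¹ : ℝ) : ℂ) • ((2 * Real.pi * Complex.I * (m.1 : ℂ)) • h m) +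
        b • ((2 * Real.pi * Complex.I * (m.1 : ℂ)) • 𝐮[U, m₀] m) := by
    intro m
    have hv : mFourierCoeff W (Fin.cons m.1 m.2) = h m := by rw [hWc]; exact ext_cons h m
    have cL : mFourierCoeff L (Fin.cons m.1 m.2) = (((-(4 * Real.pi ^ 2 * freqNormSq m.2)) : ℝ) : ℂ) • h m := by
      rw [mFourierCoeff_laplacianX_cons hW, hv]
    have cD : mFourierCoeff D (Fin.cons m.1 m.2) =
        (2 * Real.pi * Complex.I * (∑ jj : Fin 3, ((m₀ jj : ℝ) : ℂ) * ((m.2 jj : ℤ) : ℂ))) • h m := by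
      have hint : ∀ j : Fin 3, Integrable (fun y => ((m₀ j : ℝ) : ℂ) • Torus.partialDeriv (Fin.succ j) W y) volume :=
        fun j => (((hW.partialDeriv (Fin.succ j)).continuous.const_smul ((m₀ j : ℝ) : ℂ) :)).integrable_unitAddTorus
      rw [hD, mFourierCoeff_finset_sum Finset.univ (fun j _ => hint j)]
      have : ∀ j : Fin 3, mFourierCoeff (fun y => ((m₀ j : ℝ) : ℂ) • Torus.partialDeriv (Fin.succ j) W y) (Fin.cons m.1 m.2) =
          (((m₀ j : ℝ) : ℂ) * dsym j m.2) • h m := by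
        intro j
        rw [show (fun y => ((m₀ j : ℝ) : ℂ) • Torus.partialDeriv (Fin.succ j) W y) =
            ((m₀ j : ℝ) : ℂ) • Torus.partialDeriv (Fin.succ j) W from rfl, mFourierCoeff_const_smul,
          mFourierCoeff_partialDeriv_succ_cons hW, hv, smul_smul]
      simp_rw [this, ← Finset.sum_smul]
      congr 1
      rw [Finset.mul_sum]
      refine Finset.sum_congr rfl fun j _ => ?_
      rw [dsym_apply]; ring
    have cT₁ : mFourierCoeff T₁ (Fin.cons m.1 m.2) = 𝐍[𝐮[U, m₀], h] m := by
      rw [hT₁, mFourierCoeff_transport_cons hVc hW, hLh]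
    have cT₂ : mFourierCoeff T₂ (Fin.cons m.1 m.2) = 𝐍[h, 𝐮[U, m₀]] m := by
      rw [hT₂, mFourierCoeff_transport_cons hW hVc, hLh]
    have cE : mFourierCoeff E₀ (Fin.cons m.1 m.2) = ((τ⁻¹ : ℝ) : ℂ) • ((2 * Real.pi * Complex.I * (m.1 : ℂ)) • h m) := by
      rw [show E₀ = ((τ⁻¹ : ℝ) : ℂ) • Torus.partialDeriv 0 W from rfl, mFourierCoeff_const_smul,
        mFourierCoeff_partialDeriv_zero_cons hW, hv]
    have cB : mFourierCoeff B (Fin.cons m.1 m.2) = b • ((2 * Real.pi * Complex.I * (m.1 : ℂ)) • 𝐮[U, m₀] m) := by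
      rw [show B = b • Torus.partialDeriv 0 Vc from rfl, mFourierCoeff_const_smul, mFourierCoeff_partialDeriv_zero_cons hVc]
    rw [hΦ, mFourierCoeff_lincomb₆ hLs.integrable hDs.integrable hT₁s.integrable hT₂s.integrable hE₀s.integrable
      hBs.integrable, cL, cD, cT₁, cT₂, cE, cB]
  -- zero spatial modes of `Φ` vanish
  have h0' : ∀ n : ℤ, mFourierCoeff Φ (Fin.cons n 0) = 0 := by
    intro n
    have e1 := nl_cons_zero_of_rapidDecayE (a := 𝐮[U, m₀]) (b := h) hut hur hhr n
    have e2 := nl_cons_zero_of_rapidDecayE (a := h) (b := 𝐮[U, m₀]) hht hhr hur n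
    have e4 := cΦ (n, 0)
    simp only [e1, e2, hh0 n, smul_zero, sub_zero] at e4
    rw [e4, show mFourierCoeff (complexify ∘ fun y => U y - m₀) (Fin.cons n 0) = 0 from hu0 n, smul_zero, smul_zero,
      add_zero]
  -- the Leray multiplier kills the coefficients of `Φ` off the zero modes
  have hP' : ∀ (n : ℤ) (k : Fin 3 → ℤ), k ≠ 0 → Torus.lerayCoeff k (mFourierCoeff Φ (Fin.cons n k)) = 0 := by
    intro n k hk
    rw [show (Fin.cons n k : Fin 4 → ℤ) = Fin.cons ((n, k) : ℤ × (Fin 3 → ℤ)).1 ((n, k) : ℤ × (Fin 3 → ℤ)).2 from rfl, cΦ]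
    have he := hleq (n, k) hk
    let P : EuclideanSpace ℂ (Fin 3) →ₗ[ℂ] EuclideanSpace ℂ (Fin 3) :=
      { toFun := Torus.lerayCoeff k, map_add' := SteadyLattice.lerayCoeff_add' k,
        map_smul' := SteadyLattice.lerayCoeff_smul' k }
    have hPw : ∀ w, P w = Torus.lerayCoeff k w := fun w => rfl
    have Ph : Torus.lerayCoeff k (h (n, k)) = h (n, k) := SteadyLattice.lerayCoeff_of_kdot_eq_zero hk (hht (n, k))
    have Pu : Torus.lerayCoeff k (𝐮[U, m₀] (n, k)) = 𝐮[U, m₀] (n, k) :=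
      SteadyLattice.lerayCoeff_of_kdot_eq_zero hk (hut (n, k))
    set N : EuclideanSpace ℂ (Fin 3) := Torus.lerayCoeff k (𝐍[𝐮[U, m₀], h] (n, k) + 𝐍[h, 𝐮[U, m₀]] (n, k)) with hN
    set v : EuclideanSpace ℂ (Fin 3) := 𝐮[U, m₀] (n, k) with hvdef
    rw [← hPw]
    simp only [map_smul, map_sub, map_add]
    simp only [hPw, Ph, Pu]
    rw [show ∀ a c d e f g : EuclideanSpace ℂ (Fin 3), a - c - d - e - f + g = a - c - (d + e) - f + g from fun _ _ _ _ _ _ => by abel,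
      ← SteadyLattice.lerayCoeff_add']
    change _ - _ - N - _ + _ = 0
    change _ + N = _ at he
    ext i
    have hi := congrArg (fun w : EuclideanSpace ℂ (Fin 3) => w i) he
    simp only [PiLp.add_apply, PiLp.sub_apply, PiLp.smul_apply, smul_eq_mul, PiLp.zero_apply] at hi ⊢
    push_cast at hi ⊢
    linear_combination (-1 : ℂ) * hi
  obtain ⟨Q, hQs, hΦQ⟩ := exists_pressure hΦs h0' hP'
  refine ⟨Q, hQs, fun y => ?_⟩
  have hid := hΦQ y
  simp only [hΦ, hL, hD, hT₁, hT₂, hE₀, hB] at hid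
  -- `D + T₁ = ∑ⱼ Uⱼ ∂ⱼ₊₁ W`, `T₂ = ∑ⱼ Wⱼ complexify (∂ⱼ₊₁ U)`, `∂₀ Vc = complexify ∂₀ U`
  have hDT : (∑ j : Fin 3, ((m₀ j : ℝ) : ℂ) • Torus.partialDeriv (Fin.succ j) W y) +
      (∑ j : Fin 3, (Vc y) j • Torus.partialDeriv (Fin.succ j) W y) =
      ∑ j : Fin 3, (((U y) j : ℝ) : ℂ) • Torus.partialDeriv (Fin.succ j) W y := by
    rw [← Finset.sum_add_distrib]
    refine Finset.sum_congr rfl fun j _ => ?_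
    rw [← add_smul, hVcdef, Function.comp_apply, complexify_apply, PiLp.sub_apply, Complex.ofReal_sub, add_sub_cancel]
  have hT₂' : (∑ j : Fin 3, (W y) j • Torus.partialDeriv (Fin.succ j) Vc y) =
      ∑ j : Fin 3, (W y) j • complexify (Torus.partialDeriv (Fin.succ j) U y) :=
    Finset.sum_congr rfl fun j _ => by rw [hd1]
  rw [hd1, hT₂'] at hid
  rw [← hDT]
  -- rearrange
  have key : ∀ (a d t₁ t₂ e bb g : EuclideanSpace ℂ (Fin 3)), a - d - t₁ - t₂ - e + bb = g → e = a - (d + t₁) - t₂ - g + bb := by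
    intro a d t₁ t₂ e bb g hh; rw [← hh]; abel
  exact key _ _ _ _ _ _ _ hid

/-- **Spatial divergence of a synthesis** with transversal lattice family vanishes. [folklore] -/
theorem div_synth_eq_zero (hht : ∀ m : ℤ × (Fin 3 → ℤ), (∑ jj : Fin 3, ((m.2 jj : ℤ) : ℂ) * (h m) jj) = 0)
    (hhr : RapidDecay (𝐄 h)) (y : UnitAddTorus (Fin 4)) :
    ∑ i : Fin 3, Torus.partialDeriv (Fin.succ i) (fun z => (fourierSynth (𝐄 h) z) i) y = 0 := by
  have hW : IsSmooth (fourierSynth (𝐄 h)) := hhr.isSmooth_fourierSynth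
  have hWc : ∀ K, mFourierCoeff (fourierSynth (𝐄 h)) K = (𝐄 h) K := hhr.mFourierCoeff_fourierSynth
  have hWi : ∀ i, IsSmooth (fun z => (fourierSynth (𝐄 h) z) i) := isSmooth_apply hW
  set Dc : UnitAddTorus (Fin 4) → ℂ := fun z => ∑ i : Fin 3, Torus.partialDeriv (Fin.succ i) (fun w => (fourierSynth (𝐄 h) w) i) z
    with hDc
  have hDcc : Continuous Dc := continuous_finsetSum _ fun i _ => ((hWi i).partialDeriv _).continuous
  have hDc0 : Dc = 0 := by
    refine eq_zero_of_forall_mFourierCoeff_eq_zero hDcc fun K => ?_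
    rw [hDc, mFourierCoeff_finset_sum Finset.univ (fun i _ => ((hWi i).partialDeriv _).integrable)]
    rw [← Fin.cons_self_tail K]
    simp_rw [mFourierCoeff_partialDeriv (hWi _) (Fin.succ _) (Fin.cons (K 0) (Fin.tail K)), Fin.cons_succ, smul_eq_mul,
      mFourierCoeff_apply' hW, hWc]
    have := hht (K 0, Fin.tail K)
    calc ∑ x : Fin 3, 2 * Real.pi * Complex.I * ((Fin.tail K x : ℤ) : ℂ) * ((𝐄 h) (Fin.cons (K 0) (Fin.tail K))) x
        = 2 * Real.pi * Complex.I * ∑ jj : Fin 3, ((Fin.tail K jj : ℤ) : ℂ) * (h (K 0, Fin.tail K)) jj := by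
          rw [Finset.mul_sum]
          refine Finset.sum_congr rfl fun jj _ => ?_
          rw [ext_cons h (K 0, Fin.tail K)]; ring
      _ = 0 := by rw [this, mul_zero]
  have hy := congrArg (fun g : UnitAddTorus (Fin 4) → ℂ => g y) hDc0
  simpa only [hDc, Pi.zero_apply] using hy

/-- **Slice means of a synthesis** vanish when the zero spatial modes do. [folklore] -/
theorem integral_timeSlice_synth_eq_zero (hh0 : ∀ n : ℤ, h (n, 0) = 0) (hhr : RapidDecay (𝐄 h)) (c : UnitAddCircle) :
    (∫ x, timeSlice (fourierSynth (𝐄 h)) c x) = 0 := by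
  rw [← Torus.mFourierCoeff_zero_eq_integral_of_normedSpace, mFourierCoeff_timeSlice_fourierSynth hhr c 0]
  have : ∀ n : ℤ, (fourier n c : ℂ) • (𝐄 h) (Fin.cons n 0) = 0 := fun n => by
    rw [show (Fin.cons n 0 : Fin 4 → ℤ) = Fin.cons ((n, (0 : Fin 3 → ℤ)) : ℤ × (Fin 3 → ℤ)).1
      ((n, (0 : Fin 3 → ℤ)) : ℤ × (Fin 3 → ℤ)).2 from rfl, ext_cons, hh0 n, smul_zero]
  rw [tsum_congr this, tsum_zero]

/-- **From the linear rolled-up identity to the linearised system around the orbit**: with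
`U = timeRoll τ u`, `w(t,x) = W(t/τ, x)`, `q(t,x) = Q(t/τ, x)` one gets a smooth
`τ`-periodic divergence-free mean-zero solution of `∂ₜw = L_{u(t)} w − ∇q + (bτ) ∂ₜu`. [folklore] -/
theorem linear_classical {u : ℝ → UnitAddTorus (Fin 3) → EuclideanSpace ℝ (Fin 3)} (hτ : 0 < τ)
    (hsu : IsSmoothSpaceTimeOn univ u) (hper : Function.Periodic u τ)
    {W : UnitAddTorus (Fin 4) → EuclideanSpace ℂ (Fin 3)} (hW : IsSmooth W) {Q : UnitAddTorus (Fin 4) → ℂ} (hQ : IsSmooth Q)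
    (hE : ∀ y, ((τ⁻¹ : ℝ) : ℂ) • Torus.partialDeriv 0 W y =
        (ν : ℂ) • (∑ i : Fin 3, Torus.partialDeriv (Fin.succ i) (Torus.partialDeriv (Fin.succ i) W) y) -
          (∑ j : Fin 3, (((timeRoll τ u y) j : ℝ) : ℂ) • Torus.partialDeriv (Fin.succ j) W y) -
          (∑ j : Fin 3, ((W y) j) • complexify (Torus.partialDeriv (Fin.succ j) (timeRoll τ u) y)) -
          WithLp.toLp 2 (fun i : Fin 3 => Torus.partialDeriv (Fin.succ i) Q y) +
          b • complexify (Torus.partialDeriv 0 (timeRoll τ u) y))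
    (hdiv : ∀ y, ∑ i : Fin 3, Torus.partialDeriv (Fin.succ i) (fun z => (W z) i) y = 0)
    (hmean : ∀ c : UnitAddCircle, (∫ x, timeSlice W c x) = 0) :
    IsSmoothSpaceTimeOn univ (fun t : ℝ => fun x : UnitAddTorus (Fin 3) => W (Fin.cons (((τ⁻¹ * t : ℝ)) : UnitAddCircle) x)) ∧
    IsSmoothSpaceTimeOn univ (fun t : ℝ => fun x : UnitAddTorus (Fin 3) => Q (Fin.cons (((τ⁻¹ * t : ℝ)) : UnitAddCircle) x)) ∧
    (∀ t, Torus.IsDivFreeC (fun x : UnitAddTorus (Fin 3) => W (Fin.cons (((τ⁻¹ * t : ℝ)) : UnitAddCircle) x))) ∧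
    (∀ t, HasZeroMean (fun x : UnitAddTorus (Fin 3) => W (Fin.cons (((τ⁻¹ * t : ℝ)) : UnitAddCircle) x))) ∧
    Function.Periodic (fun t : ℝ => fun x : UnitAddTorus (Fin 3) => W (Fin.cons (((τ⁻¹ * t : ℝ)) : UnitAddCircle) x)) τ ∧
    ∀ t x, timeDerivWithin univ (fun t : ℝ => fun x : UnitAddTorus (Fin 3) => W (Fin.cons (((τ⁻¹ * t : ℝ)) : UnitAddCircle) x)) t x =
      Torus.linearizedNSOperator ν (u t) (fun x : UnitAddTorus (Fin 3) => W (Fin.cons (((τ⁻¹ * t : ℝ)) : UnitAddCircle) x))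
          (fun x : UnitAddTorus (Fin 3) => Q (Fin.cons (((τ⁻¹ * t : ℝ)) : UnitAddCircle) x)) x +
        (b * (τ : ℂ)) • Torus.realToComplex (timeDerivWithin univ u t x) := by
  set w : ℝ → UnitAddTorus (Fin 3) → EuclideanSpace ℂ (Fin 3) :=
    fun t x => W (Fin.cons (((τ⁻¹ * t : ℝ)) : UnitAddCircle) x) with hw
  set q : ℝ → UnitAddTorus (Fin 3) → ℂ := fun t x => Q (Fin.cons (((τ⁻¹ * t : ℝ)) : UnitAddCircle) x) with hq
  have hτi : τ⁻¹ ≠ 0 := inv_ne_zero hτ.ne'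
  have hperw : Function.Periodic w τ := by
    have := periodic_comp_cons W hτi
    rwa [inv_inv] at this
  have hrollw : timeRoll τ w = W := by
    have := timeRoll_comp_cons W hτi
    rwa [inv_inv] at this
  have hsw : IsSmoothSpaceTimeOn univ w := isSmoothSpaceTimeOn_cons hW τ⁻¹
  have hsq : IsSmoothSpaceTimeOn univ q := isSmoothSpaceTimeOn_cons hQ τ⁻¹
  refine ⟨hsw, hsq, fun t x => ?_, fun t => ?_, hperw, fun t x => ?_⟩
  · -- divergence
    change ∑ i : Fin 3, Torus.partialDeriv i (fun x' => w t x' i) x = 0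
    have : ∀ i : Fin 3, Torus.partialDeriv i (fun x' => w t x' i) x =
        Torus.partialDeriv (Fin.succ i) (fun z => (W z) i) (Fin.cons (((τ⁻¹ * t : ℝ)) : UnitAddCircle) x) := by
      intro i
      rw [partialDeriv_succ_cons]
      rfl
    simp_rw [this]
    exact hdiv _
  · -- mean
    change (∫ x, w t x) = 0
    exact hmean _
  · -- the equation at `(t, x)`, read at `y = (t/τ, x)`
    have hs : τ * (τ⁻¹ * t) = t := by field_simp
    have h0w := partialDeriv_zero_timeRoll hsw hperw (τ⁻¹ * t) x
    rw [hrollw, hs] at h0w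
    have h0u := partialDeriv_zero_timeRoll hsu hper (τ⁻¹ * t) x
    rw [hs] at h0u
    have hsl : timeSlice (timeRoll τ u) (((τ⁻¹ * t : ℝ)) : UnitAddCircle) = u t := by
      rw [timeSlice_timeRoll hper, hs]
    have hy := hE (Fin.cons (((τ⁻¹ * t : ℝ)) : UnitAddCircle) x)
    rw [h0w, h0u, ← laplacian_timeSlice hW] at hy
    -- convective term
    have hconv : (∑ j : Fin 3, (((timeRoll τ u (Fin.cons (((τ⁻¹ * t : ℝ)) : UnitAddCircle) x)) j : ℝ) : ℂ) •
        Torus.partialDeriv (Fin.succ j) W (Fin.cons (((τ⁻¹ * t : ℝ)) : UnitAddCircle) x)) =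
        Torus.convect (u t) (w t) x := by
      rw [← hsl, show w t = timeSlice W (((τ⁻¹ * t : ℝ)) : UnitAddCircle) from rfl, convect_timeSlice hW]
      exact Finset.sum_congr rfl fun j _ => Complex.coe_smul _ _
    -- stretching term
    have hstr : (∑ j : Fin 3, ((W (Fin.cons (((τ⁻¹ * t : ℝ)) : UnitAddCircle) x)) j) •
        complexify (Torus.partialDeriv (Fin.succ j) (timeRoll τ u) (Fin.cons (((τ⁻¹ * t : ℝ)) : UnitAddCircle) x))) =
        Torus.stretch (w t) (u t) x := by
      rw [Torus.stretch]
      refine Finset.sum_congr rfl fun j _ => ?_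
      rw [SteadyLattice.realToComplex_eq_complexify, ← hsl, ← partialDeriv_succ_cons]
    -- pressure term
    have hgr : (WithLp.toLp 2 (fun i : Fin 3 => Torus.partialDeriv (Fin.succ i) Q (Fin.cons (((τ⁻¹ * t : ℝ)) : UnitAddCircle) x)) :
        EuclideanSpace ℂ (Fin 3)) = Torus.gradientC (q t) x := by
      rw [Torus.gradientC]
      congr 1
      funext i
      rw [partialDeriv_succ_cons]
      rfl
    rw [hconv, hstr, hgr] at hy
    rw [Torus.linearizedNSOperator, Torus.linConvect, SteadyLattice.realToComplex_eq_complexify]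
    change timeDerivWithin univ w t x = _
    -- `hy : ↑τ⁻¹ • τ • ∂ₜw = ν • Δ(w t) x - convect - stretch - ∇q + b • complexify (τ • ∂ₜu)`
    have e1 : ((τ⁻¹ : ℝ) : ℂ) • (τ • timeDerivWithin univ w t x) = timeDerivWithin univ w t x := by
      rw [Complex.coe_smul, smul_smul, inv_mul_cancel₀ hτ.ne', one_smul]
    have e2 : b • complexify (τ • timeDerivWithin univ u t x) = (b * (τ : ℂ)) • complexify (timeDerivWithin univ u t x) := by
      rw [LinearIsometry.map_smul, ← Complex.coe_smul, smul_smul]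
    rw [e1, e2] at hy
    rw [hy, Complex.coe_smul]
    change ν • Torus.laplacian (w t) x - Torus.convect (u t) (w t) x - Torus.stretch (w t) (u t) x - Torus.gradientC (q t) x + _ =
      ν • Torus.laplacian (w t) x - (Torus.convect (u t) (w t) x + Torus.stretch (w t) (u t) x) - Torus.gradientC (q t) x + _
    abel

end Linear

/-! ## §E⁶ Identification of multiples of `∂ₜu` -/

section Identify

variable {τ : ℝ} {u : ℝ → UnitAddTorus (Fin 3) → EuclideanSpace ℝ (Fin 3)} {h : ℤ × (Fin 3 → ℤ) → EuclideanSpace ℂ (Fin 3)}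

/-- **Identification**: if the synthesis `w(t,x) = F_{𝐄 h}(t/τ, x)` is a complex multiple
`z ∂ₜu` of the time derivative of the `τ`-periodic orbit, then
`h(n,k) = (z τ⁻¹ 2πi n) û(n,k)` for all `(n,k)`. [folklore] -/
theorem coeff_eq_of_synth_eq_smul_timeDeriv (hτ : 0 < τ) (hsu : IsSmoothSpaceTimeOn univ u) (hper : Function.Periodic u τ)
    (hhr : RapidDecay (𝐄 h)) (m₀ : EuclideanSpace ℝ (Fin 3)) {z : ℂ}
    (hw : ∀ t x, fourierSynth (𝐄 h) (Fin.cons (((τ⁻¹ * t : ℝ)) : UnitAddCircle) x) =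
      z • Torus.realToComplex (timeDerivWithin univ u t x)) (m : ℤ × (Fin 3 → ℤ)) :
    h m = (z * ((τ⁻¹ : ℝ) : ℂ) * (2 * Real.pi * Complex.I * (m.1 : ℂ))) • 𝐮[timeRoll τ u, m₀] m := by
  have hU : IsSmooth (timeRoll τ u) := isSmooth_timeRoll hsu hper
  -- `W = (z τ⁻¹) • complexify ∘ ∂₀ U` on `T⁴`
  have hfun : fourierSynth (𝐄 h) = (z * ((τ⁻¹ : ℝ) : ℂ)) • (complexify ∘ Torus.partialDeriv 0 (timeRoll τ u)) := by
    funext y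
    obtain ⟨s, x, rfl⟩ := exists_eq_cons y
    have h1 := hw (τ * s) x
    rw [show τ⁻¹ * (τ * s) = s by field_simp] at h1
    have hτc : (τ : ℂ) ≠ 0 := by exact_mod_cast hτ.ne'
    rw [h1, Pi.smul_apply, Function.comp_apply, partialDeriv_zero_timeRoll hsu hper s x, LinearIsometry.map_smul,
      SteadyLattice.realToComplex_eq_complexify, ← Complex.coe_smul τ, smul_smul, Complex.ofReal_inv, mul_assoc,
      inv_mul_cancel₀ hτc, mul_one]
  have hc := congrArg (fun g : UnitAddTorus (Fin 4) → EuclideanSpace ℂ (Fin 3) => mFourierCoeff g (Fin.cons m.1 m.2)) hfun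
  simp only [hhr.mFourierCoeff_fourierSynth, Fin.cons_zero, Fin.tail_cons, Prod.mk.eta] at hc
  rw [mFourierCoeff_const_smul, coeff_partialDeriv_zero (m₀ := m₀) hU m, smul_smul] at hc
  exact hc

end Identify

end TimePeriodicLattice

end Literature.Analysis.FluidPDE
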